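import Summits.QuantumFields.YangMills.Theorems.BalabanUVNodesK0RecordFormatNamesLoc

/-!
# K0⁷ — THE RECORD-SIDE FORMAT NAMES, EDITION 16b = RC-3 (H′-lin) PLUMBING per CRIT-1 g34's SIGNING CHECKLIST (02:10:14Z), PRE-CUT RULING (T5′)(T6′) (02:14:52Z ∕
# 02:17:09Z) and typer-1's binder questions (Q-i)(Q-ii) (02:11:23Z): the TERM-INDEXED CUBE NEST `cubeNest z₀ i` (□ ⊂ □̃ ⊂ □₂ ⊂ □₃ ⊂ □₄ ⊂ □₀), `innerCube` (□₃),
# `recordWindowLoc` (□₀), the named side conditions `WindowNoWrap` ∕ `InInnerCube`, the response data AT a cube label `recordGkLocAt ∕ recordResponse9Data[From]LocAt`, the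
# GUARDED receipt `Response9DLoc` ((R1ᴰ-Loc): decay read only where the chart inputs sit in □₃) and its record instance `Response9DAtLocAt`

Cell `ym-nodeO-ideate` ∕ `ym-balaban-port`, DEFINER seat `ym-nodeO-def-1` (gen 34); `--kind definition --supports stmt-QuantumFields-20541 --as helper`; count-neutral.
[I] = [Balaban1987RG1], [15] = [Balaban1985Variational], [B6] = [Balaban1984PropagatorsII].

ANSWERS BY SIGNATURE (typer (Q-i)(Q-ii); CRIT-1 J1∕J3 (a)(c)(d)).
* (Q-i) THE CUBE INDEX IS VOLUME-INDEPENDENT: a cube label is its CENTRE as an integer vector `z₀ : Fin 4 → ℤ` (the convention of the window labels `recordE`'s `z`), realised in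
  volume `K` as the coarse site `siteOfInt F K (k+1) z₀`; `∀ z₀` therefore sits OUTSIDE the member index `n` and names the SAME window problem in members `n` and `n+1`.
* (Q-ii) THE NON-WRAPPING WINDOW is the NAMED Prop `WindowNoWrap F Mc k K z₀` (□₀ plus a unit collar inside the centred fundamental window: `2(|z₀ μ| + r₅ + 1) < N`), displayed by
  the cutter as a hypothesis — it is NOT folded into `windowDomains` (which is well-defined for every window; only row 4's transport needs no-wrap).
* J3 (c): `windowDomains` (ed.16) is the CONSTANT nest — every level's domain is the window, abrupt wall at `Λ₀ = □₀ᶜ` (A pinned to 0 there by [B6] (2.6)); print's graded cube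
  sequence `{□ⁿ}` of p.273 ([14] (1.3)–(1.6)) is not modelled — immaterial once the rows are guarded to □₃ (CRIT-1 02:14:52Z «either is fine once (T5′) guards to □₃»).
* J3 (d) ∕ (T6′): the decay row is read ONLY for domains whose chart inputs have their `(k+1)`-blocks in `innerCube z₀ = □₃` (`Response9DLoc`'s (R1ᴰ-Loc) guard, on X's inputs, not
  on the source `y`: a source outside □₀ has the ZERO localized response — absent datum); rows (R3)(R4ᴰ)(R5) unguarded ((R4ᴰ)'s left side vanishes at equal window problems under
  `WindowNoWrap` — the porter's uniqueness-transport lemma, CRIT-1 02:10:14Z; not `rfl`, not a torus fact).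
* NEST SIZES: `nestRadius Mc i := (i + 1)·Mc` (radius in coarse sites about the centre; □ = radius `Mc` ↔ print's «unions of 2^d neighbouring cubes from π_k» of side 2M, p.270) —
  the linear spacing of □̃, □₂, □₃, □₄, □₀ = □₅ is OUR normalisation of print's nest (p.270–274: ζ_□ = 1 on □₃, 0 outside □₄; (3.5) X ⊂ □₂; p.273 «□₀ = □₅»); the rows'
  constants are uniform in `z₀` and the exact print multiples are immaterial to them (REF∕CRIT-1 may re-pin `nestRadius`; nothing is asserted of it).

HONEST FRAMING.  Definitions only; NOTHING of Bałaban is asserted, ported or discharged; 27931 OPEN (row 4 MISSTATED-OBJECT, RC-3 in progress: ⁷⁗ «v10-Loc» to be cut over these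
names and signed by CRIT-1); 27930⁸∕26648 SIGNED·OPEN; K0⁷∕K-Ax OPEN; NODE O 0∕1; COUNT 8∕28 · K 1∕4 UNMOVED; finite `𝕋⁴_{L^K}` at fixed ε — NOT continuum ∕ ℝ⁴ ∕ OS; **the
Yang–Mills mass gap (Clay) is NOT proved by any of this.**  No `sorry`, `instance`, `notation`; standard axioms.
-/

noncomputable section

open scoped BigOperators Matrix.Norms.L2Operator

namespace Summit.QuantumFields.YangMills.Theorems.K0RecordFormatNames

open Literature.MathematicalPhysics.QuantumFieldTheory.Balaban1983to89
open Literature.MathematicalPhysics.QuantumFieldTheory.Balaban1983to89.Node00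
open Literature.MathematicalPhysics.QuantumFieldTheory.Balaban1983to89.T4Continuum (T4Family)
open Literature.MathematicalPhysics.QuantumFieldTheory.Balaban1983to89.B12FormatPlus (cutTo restrictCLM)

variable (F : T4Family)

/-! ## §24e  The term-indexed cube nest about a volume-independent cube label `z₀` -/

/-- **The nest radii** (coarse sites about the centre): `r_i := (i + 1)·Mc`, `i = 0 … 5` for □ ⊂ □̃ ⊂ □₂ ⊂ □₃ ⊂ □₄ ⊂ □₀ = □₅ — OUR linear spacing of print's nest
(□ = radius `Mc` = side `2M`). [cite: Balaban1987RG1, p.270 (cover by cubes □), (3.5) p.271, p.273 (□₀ = □₅), p.274 L8–9 (ζ_□)] -/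
def nestRadius (Mc : ℕ) (i : Fin 6) : ℕ := ((i : ℕ) + 1) * Mc

/-- **The centre of the cube labelled `z₀`** in volume `K`: the coarse site `siteOfInt F K (k+1) z₀` (volume-independent label, typer (Q-i)). [cite: Balaban1987RG1, (1.21) p.264, p.270] -/
def recordCubeCtr (k K : ℕ) (z₀ : Fin 4 → ℤ) : Site (F.P K) (k + 1) := siteOfInt F K (k + 1) z₀

/-- **`cubeNest F Mc k K z₀ i`** — the `i`-th cube of the nest about `z₀` (□, □̃, □₂, □₃, □₄, □₀ for `i = 0 … 5`) as the set of its coarse sites. [cite: Balaban1987RG1, p.270, (3.5) p.271, p.273, p.274 L8–9] -/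
def cubeNest (Mc k K : ℕ) (z₀ : Fin 4 → ℤ) (i : Fin 6) : Finset (Site (F.P K) (k + 1)) :=
  windowSites F k K (nestRadius Mc i) (recordCubeCtr F k K z₀)

/-- **`innerCube` := □₃** — where `ζ_□ ≡ 1` and where the localized object's bounds are READ ((3.37) «on □₃»; the (T5′)∕(R1ᴰ-Loc) region). [cite: Balaban1987RG1, p.274 L8–9, (3.37) p.277] -/
def innerCube (Mc k K : ℕ) (z₀ : Fin 4 → ℤ) : Finset (Site (F.P K) (k + 1)) := cubeNest F Mc k K z₀ 3

/-- **`recordWindowLoc` := □₀ = □₅** — the localization cube of the term: THE WINDOW of the domain problem (`windowDomains`, ed.16). [cite: Balaban1987RG1, p.273 (□₀ = □₅), p.275 L5–8] -/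
def recordWindowLoc (Mc k K : ℕ) (z₀ : Fin 4 → ℤ) : Finset (Site (F.P K) (k + 1)) := cubeNest F Mc k K z₀ 5

/-- **SIDE CONDITION `WindowNoWrap F Mc k K z₀`** (typer (Q-ii), CRIT-1 J3 (a)): □₀ plus a unit collar lies inside the CENTRED fundamental window of `T^{(k+1)}_K` —
`2·(|z₀ μ| + r₅ + 1) < N_{k+1}(K)` in every direction (so the window problem does not self-overlap and lifts isometrically to volume `K + 1`). [cite: Balaban1987RG1, (1.21) p.264, p.275 L5–8] -/
def WindowNoWrap (Mc k K : ℕ) (z₀ : Fin 4 → ℤ) : Prop :=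
  ∀ μ : Fin 4, 2 * (|z₀ μ| + (nestRadius Mc 5 : ℤ) + 1) < ((F.P K).sitesPerDir (k + 1) : ℤ)

/-- **GUARD `InInnerCube F Mc k K z₀ l`**: the label `l = (μ, y)` (the label OVER a chart input: `siteOf i`) has its block `y` in □₃. [cite: Balaban1987RG1, p.274 L9–13, (3.37) p.277] -/
def InInnerCube (Mc k K : ℕ) (z₀ : Fin 4 → ℤ) (l : RespLabel F k K) : Prop := l.2 ∈ innerCube F Mc k K z₀

/-! ## §24f  The localized response data AT a cube label, the guarded receipt -/

section Theta

variable (θ : Stage13Params F 2)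

/-- **`recordGkLocAt F θ Mc k K z₀ a l i := recordGkLocW … (recordWindowLoc … z₀) a l i`** — the two-block localized response coordinates at the term's □₀.
[cite: Balaban1987RG1, (4.35) p.290, (3.37) p.277; Balaban1985Variational, Prop. 9 p.309] -/
def recordGkLocAt (Mc k K : ℕ) (z₀ : Fin 4 → ℤ) (a : θ.ιβ) (l : RespLabel F k K) (i : Fin (recordChartDimJ F K)) : ℂ :=
  recordGkLocW F θ k K (recordWindowLoc F Mc k K z₀) a l i

/-- **The localized response data at the cube label `z₀`** (unshifted): `Gk := recordGkLocAt … z₀`, every other field as in `recordResponse9DataLoc`.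
[cite: Balaban1985Variational, Prop. 9 p.309; Balaban1987RG1, (4.35) p.290] -/
def recordResponse9DataLocAt (a : θ.ιβ) (Mc k : ℕ) (z₀ : Fin 4 → ℤ) :
    B12FormatPlus.Response9Data (recordDomSys F Mc k) (recordBondCount F) (recordChartDimJ F) 4 where
  Cc := recordCc F Mc k
  Λ := RespLabel F k
  G := recordSiteGeom F Mc k
  ρ := recordRho F k
  e := recordE F k
  cX := recordCXJ F Mc k
  siteOf := fun K => recordSiteOfJ F k K
  Gk := fun K => recordGkLocAt F θ Mc k K z₀ a
  wrap := recordWrapCtr F Mc k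
  emb := recordDomEmbCtr F Mc k
  jX := fun K _ => recordJXJ F K
  πc := fun K _ => recordCoordProjCtr F K

/-- **The localized response data at `z₀` from the base volume `K₀`** (member `n` = volume `K₀ + n`; the SAME `z₀` in every member — typer (Q-i)).
[cite: Balaban1985Variational, Prop. 9 p.309; Balaban1987RG1, (1.21) p.264, (4.35) p.290] -/
def recordResponse9DataFromLocAt (a : θ.ιβ) (Mc k K₀ : ℕ) (z₀ : Fin 4 → ℤ) :
    B12FormatPlus.Response9Data (fun n => recordDomSys F Mc k (K₀ + n)) (fun n => recordBondCount F (K₀ + n)) (fun n => recordChartDimJ F (K₀ + n)) 4 where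
  Cc := fun n => recordCc F Mc k (K₀ + n)
  Λ := fun n => RespLabel F k (K₀ + n)
  G := fun n => recordSiteGeom F Mc k (K₀ + n)
  ρ := fun n => recordRho F k (K₀ + n)
  e := fun n => recordE F k (K₀ + n)
  cX := fun n => recordCXJ F Mc k (K₀ + n)
  siteOf := fun n => recordSiteOfJ F k (K₀ + n)
  Gk := fun n => recordGkLocAt F θ Mc k (K₀ + n) z₀ a
  wrap := fun n => recordWrapCtr F Mc k (K₀ + n)
  emb := fun n => recordDomEmbCtr F Mc k (K₀ + n)
  jX := fun n _ => recordJXJ F (K₀ + n)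
  πc := fun n _ => recordCoordProjCtr F (K₀ + n)

end Theta

/-- **`Response9DLoc` — typer-1's `B12FormatPlus.Response9D` WITH THE (R1ᴰ-Loc) GUARD** (CRIT-1 (T6′) 02:17:09Z): rows (R0) constants, **(R1ᴰ-Loc)** `∀ n X y, (∀ i ∈ cX n X,
inner n (siteOf n i)) → gauge (D n X) (cutTo (cX n X) (Gk n y)) ≤ C₉·e^{−δ₀·dist(y, X)}` — the decay row read ONLY for domains whose chart inputs carry labels in the region `inner`
(print: the localized object's bounds hold on □₃ and are used only under ζ-cutoffs supported there), (R3) unwrap compatibility, (R4ᴰ) two-volume comparison, (R5) chart intertwining —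
the last three VERBATIM from `Response9D`.  Generic in the data; hypothesis form; asserts nothing. [cite: Balaban1985Variational, Prop. 9 p.309, (190) p.308; Balaban1987RG1, (4.4)–(4.5) pp.281–282, p.274 L9–13, (3.37) p.277, (1.21) p.264, (4.35) p.290] -/
def Response9DLoc {S : ℕ → LocDomainSys} {M m : ℕ → ℕ} {d : ℕ} (R : B12FormatPlus.Response9Data S M m d)
    (χ : (n : ℕ) → (S n).Dom → (Fin (m n) → ℂ) → (Fin (M n) → ℂ)) (N : ℕ → ℕ) (D : (n : ℕ) → (S n).Dom → Set (Fin (m n) → ℂ))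
    (inner : (n : ℕ) → R.Λ n → Prop) (C₉ δ₀ : ℝ) : Prop :=
  0 ≤ C₉ ∧ 0 ≤ δ₀ ∧
  (∀ n X y, (∀ i ∈ R.cX n X, inner n (R.siteOf n i)) →
    gauge (D n X) (cutTo (R.cX n X) (R.Gk n y)) ≤ C₉ * Real.exp (-δ₀ * (R.G n).distD y X)) ∧
  (∀ n X, X ∉ R.wrap n → ∀ i ∈ R.cX n X, R.jX n X i ∈ R.cX (n + 1) (R.emb n X)) ∧
  (∀ n X, X ∉ R.wrap n → ∀ (μ : Fin d) (z : Fin d → ℤ), (∀ l, 2 * |z l| < (N n : ℤ)) →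
    gauge (D n X) (cutTo (R.cX n X) fun i => R.Gk (n + 1) (R.e (n + 1) μ z) (R.jX n X i) - R.Gk n (R.e n μ z) i) ≤
      C₉ * Real.exp (-δ₀ * (N n : ℝ) / 2) * Real.exp (-(δ₀ / 2) * (R.G n).distD (R.e n μ z) X)) ∧
  (∀ n X, X ∉ R.wrap n → ∀ w', R.πc n X (χ (n + 1) (R.emb n X) w') = χ n X (restrictCLM (R.cX n X) (R.jX n X) w'))

section Theta

variable (θ : Stage13Params F 2)

/-- **RECEIPT (Loc, at the cube label `z₀`): 27931 ⁷⁗'s response half** — `Response9DLoc` for `recordResponse9DataFromLocAt … z₀` in the gauge norm of the two-block (4.4) domain,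
CENTRED layer, radius `recordRNat`, base volume `K₀`, with the (R1ᴰ-Loc) guard `InInnerCube … z₀` (instance: □₀-localized DOMAIN problem [B6] (2.5)–(2.6), Ω₀ = T, A pinned on
Λ₀ = □₀ᶜ; flat background U₀ = 1 (K7-c); linear order).  Prop-valued; asserts nothing; the cutter quantifies `∀ z₀, WindowNoWrap … z₀ →` outside, constants outside.
[cite: Balaban1985Variational, Prop. 9 p.309; Balaban1987RG1, (4.4) p.281, (4.35) p.290, (3.37) p.277, (1.21) p.264] -/
def Response9DAtLocAt (a : θ.ιβ) (Mc k K₀ : ℕ) (z₀ : Fin 4 → ℤ) (α₂ C₉ δ₀ : ℝ) : Prop :=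
  Response9DLoc (recordResponse9DataFromLocAt F θ a Mc k K₀ z₀) (fun n => recordChartJ F Mc k (K₀ + n)) (fun n => recordRNat F Mc k (K₀ + n))
    (fun n X => recordDom44J F Mc k (K₀ + n) X α₂) (fun n l => InInnerCube F Mc k (K₀ + n) z₀ l) C₉ δ₀

end Theta

end Summit.QuantumFields.YangMills.Theorems.K0RecordFormatNames

end
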